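import Summits.BirchSwinnertonDyer.Rank1Residual.GaloisImage.LocalThreeDivisibilityDeciderAt
import Summits.BirchSwinnertonDyer.Rank1Residual.GaloisImage.FormalGroupLocalDivisibilityRat
import HarnessLib

/-!
# The `3`-division YES decider in `hdiv`'s exact currency `v.adicCompletion ℚ`
# (team n1011, row T-DIV3L, FILE D4 — lead R5-83 (d))

HONEST FRAMING (cell `b2b-bsdres`, run/shared/lean/b2b/bsd-rank1-residual/, verbatim in every
file): the goal of the cell is to DELETE the COMBINATION-SHAPED residual classes of the
Birch–Swinnerton-Dyer formula for ALL analytic-rank `≤ 1` elliptic curves over `ℚ` — "full BSD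
formula for every rank `≤ 1` curve in class `C`" assembled STRICTLY from published theorems — so
that the rank-`≤ 1` remainder becomes exactly the CONSTRUCTION-SHAPED classes, which are TYPED
(missing-input `Prop`s), NOT attempted. This is not "finishing BSD". Team n1011 (N10/N11): research
route; this file is a TOOL; nothing is booked by it; no mark / label moved; X4 stays
CONSTRUCTION-SHAPED. THEOREMS only; no definition, no named fact, no `sorry`.

## What

FILE D3's YES decider `DivisionDecider.exists_three_nsmul_eq_padic_of_cert` concludes over `ℚ_[p]`;
the witness theorem `VisibleWitness.exists_sha_ne_zero_of_congr_of_locallyDivisible` asks `hdiv` at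
a place `v : HeightOneSpectrum (𝓞 ℚ)` in the currency `(W.baseChange (v.adicCompletion ℚ)).Point`.
This file composes the decider with n1011-p09's transport
`LocalDivisibility.exists_nsmul_eq_baseChange_adicCompletion_of_padic` (T-VIS3-WC FILE 2,
Mathlib `adicCompletion.padicEquiv`), consumed BY NAME: record binder `hv : primesEquiv v = p` as in
n1011-p18's `LocalThreeTorsionAdicCompletion` §3. One instance (`394227f1` at the place of `3`).

References: [SilvermanAEC2009] Ex. 3.7 (d) (provenance only).
-/

set_option autoImplicit false

noncomputable section

open scoped Classical
open WeierstrassCurve NumberField IsDedekindDomain Rat.HeightOneSpectrum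

namespace Summit.BirchSwinnertonDyer.Rank1Residual.GaloisImage.DivisionDecider

variable (p : ℕ) [hp : Fact p.Prime] (a₁ a₂ a₃ a₄ a₆ : ℤ)

/-- **THE YES DECIDER for `3`-division, `hdiv` currency.** For the place `v` of `ℚ` over `p`
(`hv : primesEquiv v = p`): `threeDivCertAt p a₁ … a₆ (num x) (den x) e` ⟹
`∃ Q : E(ℚ_v), 3 • Q = P|_{ℚ_v}` — LITERALLY the first disjunct of `hdiv` in
`VisibleWitness.exists_sha_ne_zero_of_congr_of_locallyDivisible` at `v`, transported from `ℚ_[p]`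
by n1011-p09's `LocalDivisibility.exists_nsmul_eq_baseChange_adicCompletion_of_padic`.
[folklore] -/
theorem exists_three_nsmul_eq_adicCompletion_of_cert (W : WeierstrassCurve ℚ) [W.IsElliptic]
    (hW : W = ⟨a₁, a₂, a₃, a₄, a₆⟩) {v : HeightOneSpectrum (𝓞 ℚ)} (hv : (primesEquiv v : ℕ) = p)
    {x y : ℚ} (h : W.toAffine.Nonsingular x y)
    {e : ℤ × ℕ × ℕ × ℕ} (he : threeDivCertAt p a₁ a₂ a₃ a₄ a₆ x.num x.den e = true) :
    ∃ Q : (W.baseChange (v.adicCompletion ℚ)).toAffine.Point,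
      (3 : ℕ) • Q = WeierstrassCurve.Affine.Point.baseChange (W' := W) ℚ (v.adicCompletion ℚ)
        (.some x y h) :=
  LocalDivisibility.exists_nsmul_eq_baseChange_adicCompletion_of_padic W hv (.some x y h) 3
    (exists_three_nsmul_eq_padic_of_cert p a₁ a₂ a₃ a₄ a₆ W hW h he)

/-- **Instance `394227f1` at the place of `3`** (partner of the N11 row `306621e1`; one of the five
pairs outside every formal-group road, n1011-p09 GEN 10): `hdiv`'s first disjunct at `v ∣ 3` for
the witness `P₂ = (82/9, 92/27)` itself, certificate `(116, 2, 5, 0)` by `decide +kernel`;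
ellipticity and nonsingularity displayed as binders. [folklore] -/
theorem exists_three_nsmul_eq_adicCompletion_394227f1 (W' : WeierstrassCurve ℚ) [W'.IsElliptic]
    (hW' : W' = ⟨1, -1, 0, -321, 2294⟩) {v : HeightOneSpectrum (𝓞 ℚ)}
    (hv : (primesEquiv v : ℕ) = 3) (h : W'.toAffine.Nonsingular (82 / 9) (92 / 27)) :
    ∃ Q : (W'.baseChange (v.adicCompletion ℚ)).toAffine.Point,
      (3 : ℕ) • Q = WeierstrassCurve.Affine.Point.baseChange (W' := W') ℚ (v.adicCompletion ℚ)
        (.some (82 / 9) (92 / 27) h) :=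
  exists_three_nsmul_eq_adicCompletion_of_cert 3 1 (-1) 0 (-321) 2294 W' hW' hv h
    (e := (116, 2, 5, 0)) (by decide +kernel)

end Summit.BirchSwinnertonDyer.Rank1Residual.GaloisImage.DivisionDecider

end
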